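import Summits.BirchSwinnertonDyer.BirchSwinnertonDyer.Theorems.ByReductionTypeAtTwoOrdEisensteinHalfShaCurrency
import Literature.NumberTheory.EllipticCurves.BSDQuadraticDescent
import HarnessLib

/-!
# The Eisenstein half of the `2`-adic main conjecture in `Ш`-currency, V: the descent inequality is an
# ISOGENY-CLASS statement (route ByReductionTypeAtTwo / TwoAdicConverse, crux `OrdEisensteinHalfAtTwo`,
# item stmt-BirchSwinnertonDyer-19272; seat bsd-2adic-ord-3, GEN 2)

HONEST FRAMING (cell `bsd-2adic`, HUMAN RULINGS D-0036/D-0074): THEOREMS ONLY — no definition, no named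
fact, nothing asserted, closes nothing; Cassels' isogeny invariance of the BSD quotient enters as the
displayed Literature fact `bsdRHS_eq_of_isIsogenous` (`hCassels`), as in the tree's
`Wuthrich2014.bsdp_of_isIsogenous`.

WHY. The crux is a `∀ W` over ALL members of an isogeny class, while a descent certificate is computed
at ONE member (the seat's census j251284 certifies `ord₂ #Ш_an ≤ ord₂ #Ш[2^∞]` at the class
representative of 563 of the 609 rank-`0` good-ordinary X5 classes). This file shows the certificate is
member-independent:

* `missingLowerBoundAt_of_isIsogenous` / `missingUpperBoundAt_of_isIsogenous` (any prime `p`): for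
  `ℚ`-isogenous globally minimal `W ∼ W'` with `Ш(W')` finite and `L^{(r)}(W',1) ≠ 0`, each HALF of
  Miller's currency transports, `MissingLowerBoundAt W' p → MissingLowerBoundAt W p` (and Upper):
  `#Ш_an(W) = #Ш_an(W')·#Ш(W)/#Ш(W')` (the identity inside `Wuthrich2014.bsdp_of_isIsogenous`), so
  `ord_p #Ш − ord_p #Ш_an` is an ISOGENY INVARIANT. (The tree had the transport of the WHOLE `BSD(E,p)`
  only.)
* `eisensteinAtTwo_of_katoHalf_of_missingLowerBoundAt_of_isIsogenous`: on a rank-`0` good-ordinary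
  curve `W`, PUB + the Kato half AT `W` + the descent inequality at ANY isogenous `W'` ⇒ the Eisenstein
  half at `W` (and `mazurMainConjecture_two_…`, `bsdp_two_…` likewise).

So on each certified class the Eisenstein crux reduces to the Kato crux member by member; what does NOT
transport for free is the Kato half itself (the `μ`-invariant of `X` shifts under `2`-isogenies,
Greenberg Prop. 5.13 / Schneider) — that is the sibling item's business, not touched here.

References: J. W. S. Cassels, J. reine angew. Math. 217 (1965); J. Milne, *Arithmetic Duality Theorems*,
Thm. I.7.3; R. L. Miller, LMS J. Comput. Math. 14 (2011), §1; K. Kato, Astérisque 295 (2004), Thm. 17.4.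
-/

set_option autoImplicit false

noncomputable section

open scoped Classical MatrixGroups ModularForm

open CongruenceSubgroup WeierstrassCurve Literature.NumberTheory.EllipticCurves
  Literature.NumberTheory.EllipticCurves.ModularForms Literature.NumberTheory.EllipticCurves.Rank1Residual
  Literature.NumberTheory.EllipticCurves.Rank1Residual.Typed
  Literature.NumberTheory.EllipticCurves.Wuthrich2014

namespace Summit.BirchSwinnertonDyer.BirchSwinnertonDyer.Theorems.EisensteinShaCurrency

/-! ## §6 The halves of Miller's currency transport along isogenies -/

section IsogenyHalves

variable {W W' : WeierstrassCurve ℚ} [W.IsElliptic] [W'.IsElliptic] [W.IsGloballyMinimal]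
  [W'.IsGloballyMinimal] {p : ℕ} [Fact p.Prime]

/-- **`#Ш_an` along an isogeny.** For `ℚ`-isogenous globally minimal `W ∼ W'` with `Ш(W')` finite and
`L^{(r)}(W',1)/r! ≠ 0`: `Ш(W)` is finite and `#Ш_an(W) = #Ш_an(W') · #Ш(W) / #Ш(W')` — Cassels'
invariance of the BSD quotient (`hCassels`) + invariance of the `L`-function
(`leadingLCoeff_eq_of_isIsogenous'`) + `#Ш_an · bsdRHS = L* · #Ш` (`shaAn_mul_bsdRHS`). This is the
identity inside the tree's `Wuthrich2014.bsdp_of_isIsogenous`, isolated.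
[cite: MilneADT2006, Thm. I.7.3 and Remark I.7.4] [cite: Miller2011LMS, §1 (arXiv:1010.2431 p. 3)] -/
theorem finite_sha_and_shaAn_eq_of_isIsogenous (hCassels : bsdRHS_eq_of_isIsogenous)
    (hiso : IsIsogenous W W') (hfin' : Finite W'.sha) (hlead : W'.leadingLCoeff ≠ 0) :
    Finite W.sha ∧ shaAn W = shaAn W' * (W.shaOrder : ℂ) / (W'.shaOrder : ℂ) := by
  obtain ⟨hfin, hRHS⟩ := hCassels W' W (hiso.symm_of_charZero) hfin'
  haveI : Finite W.sha := hfin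
  haveI : Finite W'.sha := hfin'
  have hlead_eq : W.leadingLCoeff = W'.leadingLCoeff := leadingLCoeff_eq_of_isIsogenous' hiso
  have hsha' : (W'.shaOrder : ℂ) ≠ 0 := by exact_mod_cast (W'.shaOrder_pos hfin').ne'
  have hRHS0 : (W'.bsdRHS : ℂ) ≠ 0 := by
    intro h0
    have h1 := shaAn_mul_bsdRHS W'
    rw [h0, mul_zero] at h1
    exact mul_ne_zero hlead hsha' h1.symm
  refine ⟨hfin, ?_⟩
  have h1 := shaAn_mul_bsdRHS W
  have h2 := shaAn_mul_bsdRHS W'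
  rw [hRHS, hlead_eq] at h1
  rw [eq_div_iff hsha']
  have h3 : shaAn W * (W'.bsdRHS : ℂ) * (W'.shaOrder : ℂ) =
      shaAn W' * (W.shaOrder : ℂ) * (W'.bsdRHS : ℂ) := by
    calc shaAn W * (W'.bsdRHS : ℂ) * (W'.shaOrder : ℂ)
        = W'.leadingLCoeff * (W.shaOrder : ℂ) * (W'.shaOrder : ℂ) := by rw [h1]
      _ = (shaAn W' * (W'.bsdRHS : ℂ)) * (W.shaOrder : ℂ) := by rw [h2]; ring
      _ = shaAn W' * (W.shaOrder : ℂ) * (W'.bsdRHS : ℂ) := by ring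
  have h4 : (shaAn W * (W'.shaOrder : ℂ)) * (W'.bsdRHS : ℂ) =
      (shaAn W' * (W.shaOrder : ℂ)) * (W'.bsdRHS : ℂ) := by
    rw [← h3]; ring
  exact mul_right_cancel₀ hRHS0 h4

/-- **The LOWER half `ord_p #Ш_an ≤ ord_p #Ш` transports along isogenies** (`W ∼ W'`, `Ш(W')` finite,
`L^{(r)}(W',1) ≠ 0`): `ord_p #Ш(W) − ord_p #Ш_an(W)` is an isogeny invariant. [cite: MilneADT2006, Thm. I.7.3]
[cite: Miller2011LMS, §1 (arXiv:1010.2431 p. 3)] -/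
theorem missingLowerBoundAt_of_isIsogenous (hCassels : bsdRHS_eq_of_isIsogenous)
    (hiso : IsIsogenous W W') (hfin' : Finite W'.sha) (hlead : W'.leadingLCoeff ≠ 0)
    (h : MissingLowerBoundAt W' p) : MissingLowerBoundAt W p := by
  obtain ⟨hfin, hkey⟩ := finite_sha_and_shaAn_eq_of_isIsogenous hCassels hiso hfin' hlead
  obtain ⟨q', hq', hv'⟩ := h
  haveI : Finite W.sha := hfin
  haveI : Finite W'.sha := hfin'
  have hsha' : (W'.shaOrder : ℂ) ≠ 0 := by exact_mod_cast (W'.shaOrder_pos hfin').ne'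
  have hshaQ : (W.shaOrder : ℚ) ≠ 0 := by exact_mod_cast (W.shaOrder_pos hfin).ne'
  have hshaQ' : (W'.shaOrder : ℚ) ≠ 0 := by exact_mod_cast (W'.shaOrder_pos hfin').ne'
  have hq0 : q' ≠ 0 := by
    rintro rfl
    have h2 := shaAn_mul_bsdRHS W'
    rw [hq', Rat.cast_zero, zero_mul] at h2
    exact mul_ne_zero hlead hsha' h2.symm
  refine ⟨q' * (W.shaOrder : ℚ) / (W'.shaOrder : ℚ), ?_, ?_⟩
  · rw [hkey, hq']
    push_cast
    rfl
  · rw [padicValRat.div (mul_ne_zero hq0 hshaQ) hshaQ', padicValRat.mul hq0 hshaQ, padicValRat.of_nat,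
      padicValRat.of_nat]
    linarith

/-- **The UPPER half `ord_p #Ш ≤ ord_p #Ш_an` transports along isogenies** likewise.
[cite: MilneADT2006, Thm. I.7.3] [cite: Miller2011LMS, §1 (arXiv:1010.2431 p. 3)] -/
theorem missingUpperBoundAt_of_isIsogenous (hCassels : bsdRHS_eq_of_isIsogenous)
    (hiso : IsIsogenous W W') (hfin' : Finite W'.sha) (hlead : W'.leadingLCoeff ≠ 0)
    (h : MissingUpperBoundAt W' p) : MissingUpperBoundAt W p := by
  obtain ⟨hfin, hkey⟩ := finite_sha_and_shaAn_eq_of_isIsogenous hCassels hiso hfin' hlead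
  obtain ⟨q', hq', hv'⟩ := h
  haveI : Finite W.sha := hfin
  haveI : Finite W'.sha := hfin'
  have hsha' : (W'.shaOrder : ℂ) ≠ 0 := by exact_mod_cast (W'.shaOrder_pos hfin').ne'
  have hshaQ : (W.shaOrder : ℚ) ≠ 0 := by exact_mod_cast (W.shaOrder_pos hfin).ne'
  have hshaQ' : (W'.shaOrder : ℚ) ≠ 0 := by exact_mod_cast (W'.shaOrder_pos hfin').ne'
  have hq0 : q' ≠ 0 := by
    rintro rfl
    have h2 := shaAn_mul_bsdRHS W'
    rw [hq', Rat.cast_zero, zero_mul] at h2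
    exact mul_ne_zero hlead hsha' h2.symm
  refine ⟨q' * (W.shaOrder : ℚ) / (W'.shaOrder : ℚ), ?_, ?_⟩
  · rw [hkey, hq']
    push_cast
    rfl
  · rw [padicValRat.div (mul_ne_zero hq0 hshaQ) hshaQ', padicValRat.mul hq0 hshaQ, padicValRat.of_nat,
      padicValRat.of_nat]
    linarith

end IsogenyHalves

/-! ## §7 Member-independence of the descent certificate for the crux at `2` -/

section IsogenyTwo

open Summit.BirchSwinnertonDyer.Rank1Residual Summit.BirchSwinnertonDyer.Rank1Residual.X5
  Summit.BirchSwinnertonDyer.BirchSwinnertonDyer.Theorems.Rank1ResidualX1Defs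

variable (W : WeierstrassCurve ℚ) [W.IsElliptic] [W.IsGloballyMinimal]

/-- On a rank-`0` curve, the descent inequality at ANY isogenous globally minimal `W'` gives it at `W`
(PUB: Cassels `hCassels`, GZK `hGZK` for the finiteness of `Ш(W')`, modularity `hmod` for
`L(W',1) ≠ 0` via `leadingLCoeff_ne_zero_holds`). [cite: MilneADT2006, Thm. I.7.3] [cite: Miller2011LMS, §1] -/
theorem missingLowerBoundAt_two_of_isIsogenous (hCassels : bsdRHS_eq_of_isIsogenous)
    (hGZK : rank_eq_analyticRank_of_analyticRank_le_one) (hmod : nonempty_modularParametrizationData)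
    (hr : W.analyticRank = 0) {W' : WeierstrassCurve ℚ} [W'.IsElliptic] [W'.IsGloballyMinimal]
    (hiso : IsIsogenous W W') (h : MissingLowerBoundAt W' 2) : MissingLowerBoundAt W 2 := by
  haveI : Fact (Nat.Prime 2) := ⟨Nat.prime_two⟩
  have hr' : W'.analyticRank = 0 := by rw [← analyticRank_eq_of_isIsogenous' hiso, hr]
  have hfin' : Finite W'.sha := (hGZK W' (by rw [hr']; exact zero_le_one)).2
  haveI : NeZero (W'.conductorNorm ℤ) := ⟨(W'.conductorNorm_pos_holds).ne'⟩
  obtain ⟨Dm⟩ := hmod W'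
  have hlead : W'.leadingLCoeff ≠ 0 := W'.leadingLCoeff_ne_zero_holds Dm.isNewformOf.hasEntireLFunction
  exact missingLowerBoundAt_of_isIsogenous hCassels hiso hfin' hlead h

/-- **The Eisenstein half at `W` from the Kato half at `W` + the descent inequality at ANY isogenous
`W'`.** Rank-`0` good-ordinary-at-`2` curve `W`; PUB as hypotheses (Kato 17.4 (1)(2) AT `2`, Greenberg
4.1 AT `2`, GZK, modularity, Cassels); the Kato half `X5.O1.MainConjectureLowerDivisibilityAtTwoOrd W`;
`W ∼ W'` and `MissingLowerBoundAt W' 2` (e.g. a 2-descent + Cassels–Tate certificate at the class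
representative). So a class's ONE descent certificate serves every member; the member-wise input that
remains is the Kato half (the `μ`-invariant is NOT an isogeny invariant).
[cite: Kato2004Asterisque, Thm. 17.4 (1)(2) (p. 273)] [cite: GreenbergLNM1716, Thm. 4.1 (p. 102)]
[cite: MilneADT2006, Thm. I.7.3] -/
theorem eisensteinAtTwo_of_katoHalf_of_missingLowerBoundAt_of_isIsogenous
    (h17 : ∀ [NeZero (W.conductorNorm ℤ)] (f : CuspForm (Gamma0 (W.conductorNorm ℤ)) 2),
      kato_divisibility_allPrimes W 2 (f := f))
    (hEC : O1.TwoAdicEulerCharRankZero W 0) (hGZK : rank_eq_analyticRank_of_analyticRank_le_one)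
    (hmod : nonempty_modularParametrizationData) (hCassels : bsdRHS_eq_of_isIsogenous)
    (hgo : GoodOrd W 2) (hr : W.analyticRank = 0) (hK : O1.MainConjectureLowerDivisibilityAtTwoOrd W)
    {W' : WeierstrassCurve ℚ} [W'.IsElliptic] [W'.IsGloballyMinimal] (hiso : IsIsogenous W W')
    (hsha' : MissingLowerBoundAt W' 2) : O1.MainConjectureEisensteinDivisibilityAtTwo W :=
  eisensteinAtTwo_of_katoHalf_of_missingLowerBoundAt W h17 hEC hGZK hmod hgo hr hK
    (missingLowerBoundAt_two_of_isIsogenous W hCassels hGZK hmod hr hiso hsha')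

/-- The same for the `2`-adic main conjecture at `W`. [cite: Kato2004Asterisque, Thm. 17.4 (1)(2) (p. 273)]
[cite: MilneADT2006, Thm. I.7.3] -/
theorem mazurMainConjecture_two_of_katoHalf_of_missingLowerBoundAt_of_isIsogenous
    (h17 : ∀ [NeZero (W.conductorNorm ℤ)] (f : CuspForm (Gamma0 (W.conductorNorm ℤ)) 2),
      kato_divisibility_allPrimes W 2 (f := f))
    (hEC : O1.TwoAdicEulerCharRankZero W 0) (hGZK : rank_eq_analyticRank_of_analyticRank_le_one)
    (hmod : nonempty_modularParametrizationData) (hCassels : bsdRHS_eq_of_isIsogenous)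
    (hgo : GoodOrd W 2) (hr : W.analyticRank = 0) (hK : O1.MainConjectureLowerDivisibilityAtTwoOrd W)
    {W' : WeierstrassCurve ℚ} [W'.IsElliptic] [W'.IsGloballyMinimal] (hiso : IsIsogenous W W')
    (hsha' : MissingLowerBoundAt W' 2) : MazurMainConjecture W 2 :=
  mazurMainConjecture_two_of_katoHalf_of_missingLowerBoundAt W h17 hEC hGZK hmod hgo hr hK
    (missingLowerBoundAt_two_of_isIsogenous W hCassels hGZK hmod hr hiso hsha')

/-- And for `BSD(W,2)`. [cite: Miller2011LMS, Def. 1.1] [cite: MilneADT2006, Thm. I.7.3] -/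
theorem bsdp_two_of_katoHalf_of_missingLowerBoundAt_of_isIsogenous
    (h17 : ∀ [NeZero (W.conductorNorm ℤ)] (f : CuspForm (Gamma0 (W.conductorNorm ℤ)) 2),
      kato_divisibility_allPrimes W 2 (f := f))
    (hEC : O1.TwoAdicEulerCharRankZero W 0) (hGZK : rank_eq_analyticRank_of_analyticRank_le_one)
    (hmod : nonempty_modularParametrizationData) (hCassels : bsdRHS_eq_of_isIsogenous)
    (hgo : GoodOrd W 2) (hr : W.analyticRank = 0) (hK : O1.MainConjectureLowerDivisibilityAtTwoOrd W)
    {W' : WeierstrassCurve ℚ} [W'.IsElliptic] [W'.IsGloballyMinimal] (hiso : IsIsogenous W W')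
    (hsha' : MissingLowerBoundAt W' 2) : BSDp W 2 :=
  bsdp_two_of_katoHalf_of_missingLowerBoundAt W h17 hEC hGZK hmod hgo hr hK
    (missingLowerBoundAt_two_of_isIsogenous W hCassels hGZK hmod hr hiso hsha')

end IsogenyTwo

/-! ## §8 Turnkey (appended): `BSD(E,2)` and the `2`-adic main conjecture at a rank-`0` good-ordinary
curve from the `μ = 0` certificate + the descent inequality, and the class close by isogeny transport -/

section Turnkey

open Summit.BirchSwinnertonDyer.Rank1Residual Summit.BirchSwinnertonDyer.Rank1Residual.X5
  Summit.BirchSwinnertonDyer.BirchSwinnertonDyer.Theorems.Rank1ResidualX1Defs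

variable (W : WeierstrassCurve ℚ) [W.IsElliptic] [W.IsGloballyMinimal]

/-- **The `2`-adic main conjecture at `W` from {`μ(X) = 0` for the cyclotomic data, Néron integrality,
the descent inequality}** on a rank-`0` good-ordinary-at-`2` curve (PUB as hypotheses). `μ = 0` gives
the Kato half (`katoMuPartAtTwo_of_mu_eq_zero` + `mainConjectureLowerDivisibilityAtTwoOrd_of_katoMuPartAtTwo`),
then `mazurMainConjecture_two_of_katoHalf_of_missingLowerBoundAt`. No `λ_an`, no `μ_an`, no Prop-5.14
point. [cite: Kato2004Asterisque, Thm. 17.4 (1)(2) (p. 273)] [cite: GreenbergLNM1716, Thm. 4.1 (p. 102)] -/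
theorem mazurMainConjecture_two_of_mu_eq_zero_of_missingLowerBoundAt
    (h17 : ∀ [NeZero (W.conductorNorm ℤ)] (f : CuspForm (Gamma0 (W.conductorNorm ℤ)) 2),
      kato_divisibility_allPrimes W 2 (f := f))
    (hper₀ : ∀ [NeZero (W.conductorNorm ℤ)] (f : CuspForm (Gamma0 (W.conductorNorm ℤ)) 2),
      IsNewformOf W f → ∀ ϖ : ℚ, (ϖ : ℝ) * W.realPeriodRat = plusPeriod f → 0 ≤ padicValRat 2 ϖ)
    (hEC : O1.TwoAdicEulerCharRankZero W 0) (hGZK : rank_eq_analyticRank_of_analyticRank_le_one)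
    (hmod : nonempty_modularParametrizationData) (hgo : GoodOrd W 2) (hr : W.analyticRank = 0)
    (hμ : ∀ (κ : ZpExtension ℚ 2) (γ : Field.absoluteGaloisGroup ℚ), κ.IsCyclotomic →
      κ.IsTopGenerator γ → IsCyclotomicVariable 2 γ → ∀ D : W.SelmerDualData κ γ, D.mu = 0)
    (hsha : MissingLowerBoundAt W 2) : MazurMainConjecture W 2 :=
  have hord : IsOrdinaryAt W 2 := hgo
  mazurMainConjecture_two_of_katoHalf_of_missingLowerBoundAt W h17 hEC hGZK hmod hgo hr
    (O1.mainConjectureLowerDivisibilityAtTwoOrd_of_katoMuPartAtTwo W h17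
      (fun f hf ϖ hϖ => O1.exists_integral_mul_padicLFunction_two_of_padicValRat_nonneg W hord hf
        (hper₀ f hf ϖ hϖ))
      (O1.katoMuPartAtTwo_of_mu_eq_zero W hμ)) hsha

/-- **`BSD(W,2)` from {`μ(X) = 0`, Néron integrality, the descent inequality}** on a rank-`0`
good-ordinary-at-`2` curve (PUB as hypotheses). [cite: Miller2011LMS, Def. 1.1]
[cite: Kato2004Asterisque, Thm. 17.4 (1)(2) (p. 273)] [cite: GreenbergLNM1716, Thm. 4.1 (p. 102)] -/
theorem bsdp_two_of_mu_eq_zero_of_missingLowerBoundAt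
    (h17 : ∀ [NeZero (W.conductorNorm ℤ)] (f : CuspForm (Gamma0 (W.conductorNorm ℤ)) 2),
      kato_divisibility_allPrimes W 2 (f := f))
    (hper₀ : ∀ [NeZero (W.conductorNorm ℤ)] (f : CuspForm (Gamma0 (W.conductorNorm ℤ)) 2),
      IsNewformOf W f → ∀ ϖ : ℚ, (ϖ : ℝ) * W.realPeriodRat = plusPeriod f → 0 ≤ padicValRat 2 ϖ)
    (hEC : O1.TwoAdicEulerCharRankZero W 0) (hGZK : rank_eq_analyticRank_of_analyticRank_le_one)
    (hmod : nonempty_modularParametrizationData) (hgo : GoodOrd W 2) (hr : W.analyticRank = 0)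
    (hμ : ∀ (κ : ZpExtension ℚ 2) (γ : Field.absoluteGaloisGroup ℚ), κ.IsCyclotomic →
      κ.IsTopGenerator γ → IsCyclotomicVariable 2 γ → ∀ D : W.SelmerDualData κ γ, D.mu = 0)
    (hsha : MissingLowerBoundAt W 2) : BSDp W 2 :=
  have hord : IsOrdinaryAt W 2 := hgo
  bsdp_two_of_katoHalf_of_missingLowerBoundAt W h17 hEC hGZK hmod hgo hr
    (O1.mainConjectureLowerDivisibilityAtTwoOrd_of_katoMuPartAtTwo W h17
      (fun f hf ϖ hϖ => O1.exists_integral_mul_padicLFunction_two_of_padicValRat_nonneg W hord hf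
        (hper₀ f hf ϖ hϖ))
      (O1.katoMuPartAtTwo_of_mu_eq_zero W hμ)) hsha

/-- **Tower-gap form**: `TowerGapAtTwo W` (⟺ `X` torsion ∧ `μ₂ = 0` for the cyclotomic data) +
Néron integrality + the descent inequality ⇒ the `2`-adic main conjecture at `W`.
[cite: Washington1997, §13.2] [cite: Kato2004Asterisque, Thm. 17.4 (1)(2) (p. 273)] -/
theorem mazurMainConjecture_two_of_towerGap_of_missingLowerBoundAt
    (h17 : ∀ [NeZero (W.conductorNorm ℤ)] (f : CuspForm (Gamma0 (W.conductorNorm ℤ)) 2),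
      kato_divisibility_allPrimes W 2 (f := f))
    (hper₀ : ∀ [NeZero (W.conductorNorm ℤ)] (f : CuspForm (Gamma0 (W.conductorNorm ℤ)) 2),
      IsNewformOf W f → ∀ ϖ : ℚ, (ϖ : ℝ) * W.realPeriodRat = plusPeriod f → 0 ≤ padicValRat 2 ϖ)
    (hEC : O1.TwoAdicEulerCharRankZero W 0) (hGZK : rank_eq_analyticRank_of_analyticRank_le_one)
    (hmod : nonempty_modularParametrizationData) (hgo : GoodOrd W 2) (hr : W.analyticRank = 0)
    (hgap : O1.TowerGapAtTwo W) (hsha : MissingLowerBoundAt W 2) : MazurMainConjecture W 2 :=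
  mazurMainConjecture_two_of_mu_eq_zero_of_missingLowerBoundAt W h17 hper₀ hEC hGZK hmod hgo hr
    (fun _ _ hκ hγ hγ' D => (O1.isTorsion_and_mu_eq_zero_of_towerGapAtTwo W hgap hκ hγ hγ' D).2) hsha

/-- **Tower-gap form for `BSD(W,2)`.** [cite: Washington1997, §13.2] [cite: Miller2011LMS, Def. 1.1] -/
theorem bsdp_two_of_towerGap_of_missingLowerBoundAt
    (h17 : ∀ [NeZero (W.conductorNorm ℤ)] (f : CuspForm (Gamma0 (W.conductorNorm ℤ)) 2),
      kato_divisibility_allPrimes W 2 (f := f))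
    (hper₀ : ∀ [NeZero (W.conductorNorm ℤ)] (f : CuspForm (Gamma0 (W.conductorNorm ℤ)) 2),
      IsNewformOf W f → ∀ ϖ : ℚ, (ϖ : ℝ) * W.realPeriodRat = plusPeriod f → 0 ≤ padicValRat 2 ϖ)
    (hEC : O1.TwoAdicEulerCharRankZero W 0) (hGZK : rank_eq_analyticRank_of_analyticRank_le_one)
    (hmod : nonempty_modularParametrizationData) (hgo : GoodOrd W 2) (hr : W.analyticRank = 0)
    (hgap : O1.TowerGapAtTwo W) (hsha : MissingLowerBoundAt W 2) : BSDp W 2 :=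
  bsdp_two_of_mu_eq_zero_of_missingLowerBoundAt W h17 hper₀ hEC hGZK hmod hgo hr
    (fun _ _ hκ hγ hγ' D => (O1.isTorsion_and_mu_eq_zero_of_towerGapAtTwo W hgap hκ hγ hγ' D).2) hsha

/-- **CLASS CLOSE, turnkey.** `BSD(W,2)` at ANY member `W` of the isogeny class from the data at ONE
rank-`0` good-ordinary member `W₀`: PUB (Kato 17.4 (1)(2) AT `2` for `W₀`, Greenberg 4.1 AT `2` for `W₀`,
GZK, modularity, Cassels' isogeny invariance `hCassels`) + at `W₀`: Néron integrality, `μ(X) = 0` for the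
cyclotomic data, and the descent inequality `MissingLowerBoundAt W₀ 2`. (`BSD(·,2)` transports by the
tree's `Wuthrich2014.bsdp_of_isIsogenous`; the HALVES at `W` would need `μ`-information at `W`.)
[cite: MilneADT2006, Thm. I.7.3] [cite: Miller2011LMS, §1] [cite: Kato2004Asterisque, Thm. 17.4 (1)(2) (p. 273)] -/
theorem bsdp_two_of_isIsogenous_of_mu_eq_zero_of_missingLowerBoundAt
    (hCassels : bsdRHS_eq_of_isIsogenous) (hGZK : rank_eq_analyticRank_of_analyticRank_le_one)
    (hmod : nonempty_modularParametrizationData) {W₀ : WeierstrassCurve ℚ} [W₀.IsElliptic]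
    [W₀.IsGloballyMinimal] (hiso : IsIsogenous W W₀)
    (h17₀ : ∀ [NeZero (W₀.conductorNorm ℤ)] (f : CuspForm (Gamma0 (W₀.conductorNorm ℤ)) 2),
      kato_divisibility_allPrimes W₀ 2 (f := f))
    (hper₀ : ∀ [NeZero (W₀.conductorNorm ℤ)] (f : CuspForm (Gamma0 (W₀.conductorNorm ℤ)) 2),
      IsNewformOf W₀ f → ∀ ϖ : ℚ, (ϖ : ℝ) * W₀.realPeriodRat = plusPeriod f → 0 ≤ padicValRat 2 ϖ)
    (hEC₀ : O1.TwoAdicEulerCharRankZero W₀ 0) (hgo₀ : GoodOrd W₀ 2) (hr₀ : W₀.analyticRank = 0)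
    (hμ₀ : ∀ (κ : ZpExtension ℚ 2) (γ : Field.absoluteGaloisGroup ℚ), κ.IsCyclotomic →
      κ.IsTopGenerator γ → IsCyclotomicVariable 2 γ → ∀ D : W₀.SelmerDualData κ γ, D.mu = 0)
    (hsha₀ : MissingLowerBoundAt W₀ 2) : BSDp W 2 := by
  haveI : Fact (Nat.Prime 2) := ⟨Nat.prime_two⟩
  have hfin₀ : Finite W₀.sha := (hGZK W₀ (by rw [hr₀]; exact zero_le_one)).2
  haveI : NeZero (W₀.conductorNorm ℤ) := ⟨(W₀.conductorNorm_pos_holds).ne'⟩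
  obtain ⟨Dm⟩ := hmod W₀
  have hlead₀ : W₀.leadingLCoeff ≠ 0 := W₀.leadingLCoeff_ne_zero_holds Dm.isNewformOf.hasEntireLFunction
  exact bsdp_of_isIsogenous hCassels hiso hfin₀ hlead₀
    (bsdp_two_of_mu_eq_zero_of_missingLowerBoundAt W₀ h17₀ hper₀ hEC₀ hGZK hmod hgo₀ hr₀ hμ₀ hsha₀)

end Turnkey

end Summit.BirchSwinnertonDyer.BirchSwinnertonDyer.Theorems.EisensteinShaCurrency

end
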